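import Mathlib

/-!
# `GrenetZeon.DualUnipotentThreeHalves` (stmt-ValiantsHypothesis-24318), R2 heavy-top instrument — THEOREM C(7) PORT:
# CERTIFICATES for the lowest weight `−4` (generated; pure algebra)

Experiment cell «val-heavytop-census» (D-0160), engine seat val-htc-eng-1 g4 (generator `eng-1/g4/py/gen_certs.py`; exact tracked Buchberger over ℚ +
Rabinowitsch, cofactors re-verified by the kernel).  Setting (Theorem C(6) port): `W ≤ M_6(ℂ)` is a linear space of nilpotent matrices (the
graded limit of a type-`(6)` codimension-one nilpotent space) whose lowest weight is `−4`; `c` is a weight-`(−4)` vector (`Y_c = Σ_b c_b E_{b+4,b} ∈ W`);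
`J ∈ W`; and, with `h*` the deficient height of the trace-orthogonality count, `J^h ∈ W` for `2 ≤ h ≤ 5`, `h ≠ h*`, every unit `E_{ij}` with
`4 < j − i ≤ 5`, `j − i ≠ h*` lies in `W`, and the window-sum member `C̃_c ∈ W` when `h* ≠ 1`.

* `cert_h1 … cert_h6` — for each deficient height `h*`: the probe-trace polynomials (✓ `…ThmCProbesS4`) vanish ⇒
  `c = 0` (Nullstellensatz certificates `μ^K = Σ a_k p_k`, kernel-checked by `linear_combination`).

Honest framing: computational lemmas of the instrument's kernel port of Thm C(7); nothing here proves or refutes `HeavyTopLaw`/`HeavyTopSlowLaw`, 24318, S3 or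
8062; `VP ≠ VNP` is NOT proved.  No definitions.  [this seat; method: lead-g2 `THMC-CHECK.md` kernel leg, generalised to per-variable radical membership]
-/

-- single-conjunct layout: Sub = Summit, duplicated namespace component intended
set_option linter.dupNamespace false
set_option linter.unusedVariables false
set_option linter.unreachableTactic false
set_option linter.unusedTactic false

namespace Summit.ValiantsHypothesis.ValiantsHypothesis.Theorems.GrenetZeon.HeavyTopThmC6CertsS4

open Matrix

set_option maxHeartbeats 4000000 in
/-- Certificate, `s = 4`, deficient height `h* = 1`: the 3 probe polynomials [tr(JY)^5, cl0mod4(J4Y)^2, cl1mod4(J4Y)^2] force `c = 0`. -/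
theorem cert_h1 (c : Fin 6 → ℂ) (h0 : (5 : ℂ) * c 0 + (5 : ℂ) * c 1 = 0) (h1 : (2 : ℂ) * c 0 = 0) (h2 : (2 : ℂ) * c 1 = 0) :
    ∀ i : Fin 6, (i : ℕ) + 4 ≤ 5 → c i = 0 := by
  have p_v0 : (c 0) ^ 1 = 0 := by
    linear_combination (((1 : ℂ)/5)) * h0 + (((-1 : ℂ)/2)) * h2
  have e_v0 : c 0 = 0 := (pow_eq_zero_iff (by norm_num : (1 : ℕ) ≠ 0)).mp p_v0
  have p_v1 : (c 1) ^ 1 = 0 := by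
    linear_combination (((1 : ℂ)/2)) * h2
  have e_v1 : c 1 = 0 := (pow_eq_zero_iff (by norm_num : (1 : ℕ) ≠ 0)).mp p_v1
  refine fun i hi => ?_
  fin_cases i <;> first | exact e_v0 | exact e_v1 | exact absurd hi (by decide)

set_option maxHeartbeats 4000000 in
/-- Certificate, `s = 4`, deficient height `h* = 2`: the 7 probe polynomials [tr(JY)^5, cl0mod4(J4Y)^2, cl1mod4(J4Y)^2, tr(JC)^2, tr(JC)^4, tr(JC)^6, tr(E05YC)^3] force `c = 0`. -/
theorem cert_h2 (c : Fin 6 → ℂ) (h0 : (5 : ℂ) * c 0 + (5 : ℂ) * c 1 = 0) (h1 : (2 : ℂ) * c 0 = 0) (h2 : (2 : ℂ) * c 1 = 0) (h3 : (8 : ℂ) * c 0 + (8 : ℂ) * c 1 = 0) (h4 : (20 : ℂ) * c 0 * c 0 + (36 : ℂ) * c 0 * c 1 + (20 : ℂ) * c 1 * c 1 = 0) (h5 : (56 : ℂ) * c 0 * c 0 * c 0 + (150 : ℂ) * c 0 * c 0 * c 1 + (150 : ℂ) * c 0 * c 1 * c 1 + (56 : ℂ) * c 1 * c 1 * c 1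 = 0) (h6 : (6 : ℂ) * c 0 * c 1 = 0) :
    ∀ i : Fin 6, (i : ℕ) + 4 ≤ 5 → c i = 0 := by
  have p_v0 : (c 0) ^ 1 = 0 := by
    linear_combination (((1 : ℂ)/5)) * h0 + (((-1 : ℂ)/2)) * h2
  have e_v0 : c 0 = 0 := (pow_eq_zero_iff (by norm_num : (1 : ℕ) ≠ 0)).mp p_v0
  have p_v1 : (c 1) ^ 1 = 0 := by
    linear_combination (((1 : ℂ)/2)) * h2
  have e_v1 : c 1 = 0 := (pow_eq_zero_iff (by norm_num : (1 : ℕ) ≠ 0)).mp p_v1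
  refine fun i hi => ?_
  fin_cases i <;> first | exact e_v0 | exact e_v1 | exact absurd hi (by decide)

set_option maxHeartbeats 4000000 in
/-- Certificate, `s = 4`, deficient height `h* = 3`: the 7 probe polynomials [tr(JY)^5, cl0mod4(J4Y)^2, cl1mod4(J4Y)^2, tr(JC)^2, tr(JC)^4, tr(JC)^6, tr(E05YC)^3] force `c = 0`. -/
theorem cert_h3 (c : Fin 6 → ℂ) (h0 : (5 : ℂ) * c 0 + (5 : ℂ) * c 1 = 0) (h1 : (2 : ℂ) * c 0 = 0) (h2 : (2 : ℂ) * c 1 = 0) (h3 : (8 : ℂ) * c 0 + (8 : ℂ) * c 1 = 0) (h4 : (20 : ℂ) * c 0 * c 0 + (36 : ℂ) * c 0 * c 1 + (20 : ℂ) * c 1 * c 1 = 0) (h5 : (56 : ℂ) * c 0 * c 0 * c 0 + (150 : ℂ) * c 0 * c 0 * c 1 + (150 : ℂ) * c 0 * c 1 * c 1 + (56 : ℂ) * c 1 * c 1 * c 1 = 0) (h6 : (6 : ℂ) * c 0 * c 1 = 0) :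
    ∀ i : Fin 6, (i : ℕ) + 4 ≤ 5 → c i = 0 := by
  have p_v0 : (c 0) ^ 1 = 0 := by
    linear_combination (((1 : ℂ)/5)) * h0 + (((-1 : ℂ)/2)) * h2
  have e_v0 : c 0 = 0 := (pow_eq_zero_iff (by norm_num : (1 : ℕ) ≠ 0)).mp p_v0
  have p_v1 : (c 1) ^ 1 = 0 := by
    linear_combination (((1 : ℂ)/2)) * h2
  have e_v1 : c 1 = 0 := (pow_eq_zero_iff (by norm_num : (1 : ℕ) ≠ 0)).mp p_v1
  refine fun i hi => ?_
  fin_cases i <;> first | exact e_v0 | exact e_v1 | exact absurd hi (by decide)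

set_option maxHeartbeats 4000000 in
/-- Certificate, `s = 4`, deficient height `h* = 4`: the 5 probe polynomials [tr(JY)^5, tr(JC)^2, tr(JC)^4, tr(JC)^6, tr(E05YC)^3] force `c = 0`. -/
theorem cert_h4 (c : Fin 6 → ℂ) (h0 : (5 : ℂ) * c 0 + (5 : ℂ) * c 1 = 0) (h1 : (8 : ℂ) * c 0 + (8 : ℂ) * c 1 = 0) (h2 : (20 : ℂ) * c 0 * c 0 + (36 : ℂ) * c 0 * c 1 + (20 : ℂ) * c 1 * c 1 = 0) (h3 : (56 : ℂ) * c 0 * c 0 * c 0 + (150 : ℂ) * c 0 * c 0 * c 1 + (150 : ℂ) * c 0 * c 1 * c 1 + (56 : ℂ) * c 1 * c 1 * c 1 = 0) (h4 : (6 : ℂ) * c 0 * c 1 = 0) :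
    ∀ i : Fin 6, (i : ℕ) + 4 ≤ 5 → c i = 0 := by
  have p_v0 : (c 0) ^ 2 = 0 := by
    linear_combination (((-4 : ℂ)/5) * c 0 + (-1 : ℂ) * c 1) * h0 + (((1 : ℂ)/4)) * h2
  have e_v0 : c 0 = 0 := (pow_eq_zero_iff (by norm_num : (2 : ℕ) ≠ 0)).mp p_v0
  have p_v1 : (c 1) ^ 2 = 0 := by
    linear_combination (((1 : ℂ)/5) * c 1) * h0 + (((-1 : ℂ)/6)) * h4
  have e_v1 : c 1 = 0 := (pow_eq_zero_iff (by norm_num : (2 : ℕ) ≠ 0)).mp p_v1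
  refine fun i hi => ?_
  fin_cases i <;> first | exact e_v0 | exact e_v1 | exact absurd hi (by decide)

set_option maxHeartbeats 4000000 in
/-- Certificate, `s = 4`, deficient height `h* = 5`: the 6 probe polynomials [tr(JY)^5, cl0mod4(J4Y)^2, cl1mod4(J4Y)^2, tr(JC)^2, tr(JC)^4, tr(JC)^6] force `c = 0`. -/
theorem cert_h5 (c : Fin 6 → ℂ) (h0 : (5 : ℂ) * c 0 + (5 : ℂ) * c 1 = 0) (h1 : (2 : ℂ) * c 0 = 0) (h2 : (2 : ℂ) * c 1 = 0) (h3 : (8 : ℂ) * c 0 + (8 : ℂ) * c 1 = 0) (h4 : (20 : ℂ) * c 0 * c 0 + (36 : ℂ) * c 0 * c 1 + (20 : ℂ) * c 1 * c 1 = 0) (h5 : (56 : ℂ) * c 0 * c 0 * c 0 + (150 : ℂ) * c 0 * c 0 * c 1 + (150 : ℂ) * c 0 * c 1 * c 1 + (56 : ℂ) * c 1 * c 1 * c 1 = 0) :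
    ∀ i : Fin 6, (i : ℕ) + 4 ≤ 5 → c i = 0 := by
  have p_v0 : (c 0) ^ 1 = 0 := by
    linear_combination (((1 : ℂ)/5)) * h0 + (((-1 : ℂ)/2)) * h2
  have e_v0 : c 0 = 0 := (pow_eq_zero_iff (by norm_num : (1 : ℕ) ≠ 0)).mp p_v0
  have p_v1 : (c 1) ^ 1 = 0 := by
    linear_combination (((1 : ℂ)/2)) * h2
  have e_v1 : c 1 = 0 := (pow_eq_zero_iff (by norm_num : (1 : ℕ) ≠ 0)).mp p_v1
  refine fun i hi => ?_
  fin_cases i <;> first | exact e_v0 | exact e_v1 | exact absurd hi (by decide)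

end Summit.ValiantsHypothesis.ValiantsHypothesis.Theorems.GrenetZeon.HeavyTopThmC6CertsS4
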